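import Mathlib
import Literature.Analysis.FluidPDE.TypeIAncientMild
import Literature.Analysis.FluidPDE.OseenSlice
import Literature.Analysis.FluidPDE.KNSSTypeIRateLiouvilleHolds
import Literature.Analysis.FluidPDE.AxisymmetricHeatFlow
import Literature.Analysis.FluidPDE.OseenKernelLineIntegrals
import HarnessLib

/-!
# Route SymmetryModuliCount — crux `HelicalEndLiouville` (stmt-NavierStokesRegularity-14062),
# line `vanishing-cell-reynolds`, stub 6: the 2.5-D leaf on an end, direction-free

What is proved (`stub_lineLiouvilleEnd`): an element `u` of the Type-I ancient mild class `A_C`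
(`IsTypeIAncientMild C u`, KNSS/Oseen gauge) which, on a backward end `t < T ≤ 0`, is invariant
under ALL translations along a line `ℝL` (`L ≠ 0`) vanishes on that end.

Proof.
1. *Rotation covariance of `A_C`* (`lineLeaf_isTypeIAncientMild_conj`): for a linear isometry
   `R` of `ℝ³` the conjugate field `(t, y) ↦ R (u t (R⁻¹ y))` is again in `A_C` — the
   Oseen–Koch–Tataru kernel is built from inner products and radial Gaussian weights, so
   `K(τ, Rz)[Ra, Rb] = R K(τ, z)[a, b]` (`lineLeaf_oseenKernel_map`) and the Duhamel term is
   covariant (`lineLeaf_oseenDuhamel_conj`, change of variables `y ↦ Ry`, `R` measure preserving);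
   the heat flow commutes with isometries (`lineLeaf_heatFlow_conj`, tree lemmas
   `heatExtension_comp_linearIsometryEquiv`, `heatExtension_continuousLinearEquiv_comp`);
   divergence-freeness is conjugation invariant (tree lemma
   `VectorCalculus.IsDivFree.conj_linearIsometryEquiv`); the Type-I bound is preserved since `R`
   is norm preserving.
2. *Householder* (`lineLeaf_exists_linearIsometryEquiv_map_eq_single`): a linear isometry `R` with
   `R L = ‖L‖ e₂` (`Submodule.reflection_sub`). Then `R⁻¹(δ e₂) = (δ/‖L‖) L`, so the conjugate
   field is invariant under all translations along `e₂` on `t < T`.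
3. *The `x₂`-leaf on an end* (`lineLeaf_axis1`): shift time by `σ = (−T − t₀)/2 > 0`
   (`IsTypeIAncientMild.comp_sub_right`), which makes the field bounded by `C/√σ` on `t < 0` and
   `e₂`-invariant on all of `t < 0`, and apply the PROVED tree theorem
   `KNSS2009_typeI_rate_liouville_holds` (KNSS 2009, proof of Thm 6.2 with Thm 5.1: a bounded
   ancient mild field independent of `x₂` with `√(−t)|u| ≤ C` vanishes).
4. Undo the rotation: `R (u t₀ x₀) = 0` gives `u t₀ x₀ = 0`.

The rotation-covariance lemmas are adapted from the disprover's sorry-free workfile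
`Cruxes/HelicalEndLiouville/Disproof.lean` (§ rotation covariance, `translationLeaf_axis1`,
`translationLeaf`), specialised to `ℝ³` and with the conjugate field inlined. (The same lemmas,
generic in `E`, have meanwhile landed in
`Theorems/SymmetryModuliCountSymmetricLiouvilleRotationCovariance.lean`
(`SymmetryModuliCountSymmetricLiouville.stub_rotationCovariance`); that module was not yet built
on the check farm when this file was submitted, so the `ℝ³` copies are kept here.)

References: G. Koch, N. Nadirashvili, G. Seregin, V. Šverák, *Liouville theorems for the
Navier–Stokes equations and applications*, Acta Math. 203 (2009) = arXiv:0709.3599, proof of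
Thm 6.2 (p. 13) with Thm 5.1 (p. 9). [KochNadirashviliSereginSverak2009]
-/

noncomputable section

-- the summit and its single sub-problem share the name (CONVENTIONS §1), as in every Theorems file
set_option linter.dupNamespace false

open Set MeasureTheory Function Filter
open Literature.Analysis.FluidPDE
open Literature.Analysis.UnboundedOperators (heatExtension)
open scoped RealInnerProductSpace Topology

namespace Summit.NavierStokesRegularity.NavierStokesRegularity.Theorems

local notation "E3" => EuclideanSpace ℝ (Fin 3)

/-! ### Rotation covariance of the Oseen class on `ℝ³` -/

-- adapted from Cruxes/HelicalEndLiouville/Disproof.lean §rotation covariance (`oseenKernel_map`,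
-- `integral_comp_comm_lie`, `oseenDuhamel_conjField`, `heatFlow_conj`,
-- `isTypeIAncientMild_conjField`), specialised to `ℝ³`, the conjugate field inlined

/-- **The Oseen–Koch–Tataru kernel is rotation covariant**: `K(τ, Rz)[Ra, Rb] = R K(τ, z)[a, b]`
for a linear isometry `R` (the closed form is built from inner products and the radial weights
`G_τ`, `A`, `B`). [folklore] -/
theorem lineLeaf_oseenKernel_map (R : E3 ≃ₗᵢ[ℝ] E3) (τ : ℝ) (z a b : E3) :
    oseenKernel τ (R z) (R a) (R b) = R (oseenKernel τ z a b) := by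
  have hn : ‖R z‖ = ‖z‖ := R.norm_map z
  simp only [oseenKernel, LinearIsometryEquiv.inner_map_map, heatKernel_eq_of_norm_eq hn,
    oseenWeightA_eq_of_norm_eq hn, oseenWeightB_eq_of_norm_eq hn, map_add, map_sub,
    LinearIsometryEquiv.map_smul]

/-- A linear isometry commutes with the Bochner integral (no integrability needed: it is a
continuous linear equivalence). [folklore] -/
theorem lineLeaf_integral_comp_comm {X : Type*} [MeasurableSpace X] (μ : Measure X)
    (R : E3 ≃ₗᵢ[ℝ] E3) (f : X → E3) : ∫ x, R (f x) ∂μ = R (∫ x, f x ∂μ) :=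
  R.toContinuousLinearEquiv.integral_comp_comm f

/-- **The Oseen–Duhamel term is rotation covariant**:
`B^ν_s(R u R⁻¹, R v R⁻¹)(t)(x) = R · B^ν_s(u, v)(t)(R⁻¹x)` (change of variables `y ↦ Ry` in the
space integral, `R` preserves Lebesgue measure, and `lineLeaf_oseenKernel_map`). [folklore] -/
theorem lineLeaf_oseenDuhamel_conj (R : E3 ≃ₗᵢ[ℝ] E3) (ν s : ℝ) (u v : ℝ → E3 → E3) (t : ℝ)
    (x : E3) :
    oseenDuhamel ν s (fun τ y => R (u τ (R.symm y))) (fun τ y => R (v τ (R.symm y))) t x =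
      R (oseenDuhamel ν s u v t (R.symm x)) := by
  simp only [oseenDuhamel_apply]
  rw [← lineLeaf_integral_comp_comm]
  refine setIntegral_congr_fun measurableSet_Ioo fun τ _ => ?_
  rw [← lineLeaf_integral_comp_comm]
  have hmp : MeasurePreserving R volume volume := R.measurePreserving
  rw [← hmp.integral_comp R.toHomeomorph.measurableEmbedding
    (fun y => oseenKernel (ν * (t - τ)) (x - y) (R (u τ (R.symm y))) (R (v τ (R.symm y))))]
  congr 1
  funext y
  have e : x - R y = R (R.symm x - y) := by simp [map_sub]
  simp only [LinearIsometryEquiv.symm_apply_apply]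
  rw [e, lineLeaf_oseenKernel_map]

/-- **The heat flow is rotation covariant**: `e^{σΔ}(R φ R⁻¹)(x) = R · (e^{σΔ}φ)(R⁻¹x)` (the heat
kernel is radial; including the junk range `σ ≤ 0` where both sides are `R φ R⁻¹`). [folklore] -/
theorem lineLeaf_heatFlow_conj (R : E3 ≃ₗᵢ[ℝ] E3) (φ : E3 → E3) (σ : ℝ) (x : E3) :
    heatFlow (fun y => R (φ (R.symm y))) σ x = R (heatFlow φ σ (R.symm x)) := by
  rcases le_or_gt σ 0 with h | h
  · simp [heatFlow_of_nonpos _ h]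
  · rw [heatFlow_of_pos _ h, heatFlow_of_pos _ h,
      heatExtension_comp_linearIsometryEquiv R.symm (fun z => R (φ z)) σ x]
    have e : (fun z => R (φ z)) = fun z => R.toContinuousLinearEquiv (φ z) := rfl
    rw [e, heatExtension_continuousLinearEquiv_comp]
    rfl

/-- **`A_C` is rotation invariant**: if `u ∈ A_C` and `R` is a linear isometry of `ℝ³`, the
conjugate field `(t, y) ↦ R (u t (R⁻¹ y))` is in `A_C` (joint smoothness by composition with
linear maps; divergence-freeness by `div (R v R⁻¹) = (div v) ∘ R⁻¹`; the Oseen identity by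
`lineLeaf_oseenDuhamel_conj` and `lineLeaf_heatFlow_conj`; the Type-I bound since `R` preserves
norms — KNSS 2009, §1: the symmetries of the problem). [folklore] -/
theorem lineLeaf_isTypeIAncientMild_conj {C : ℝ} {u : ℝ → E3 → E3} (h : IsTypeIAncientMild C u)
    (R : E3 ≃ₗᵢ[ℝ] E3) : IsTypeIAncientMild C (fun t y => R (u t (R.symm y))) := by
  refine ⟨?_, fun t ht => ?_, fun s t hst ht x => ?_, fun t ht x => ?_⟩
  · -- joint smoothness
    have e : uncurry (fun t y => R (u t (R.symm y))) =
        (fun z : E3 => R.toContinuousLinearEquiv z) ∘ uncurry u ∘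
          fun p : ℝ × E3 => (p.1, R.symm.toContinuousLinearEquiv p.2) := by
      funext p; rfl
    rw [e]
    refine R.toContinuousLinearEquiv.contDiff.comp_contDiffOn (h.contDiffOn.comp ?_ ?_)
    · exact (contDiff_fst.prodMk
        (R.symm.toContinuousLinearEquiv.contDiff.comp contDiff_snd)).contDiffOn
    · intro p hp
      exact ⟨hp.1, mem_univ _⟩
  · -- divergence free
    exact VectorCalculus.IsDivFree.conj_linearIsometryEquiv R (h.isDivFree ht)
  · -- the Oseen identity
    show R (u t (R.symm x)) = heatFlow (fun y => R (u s (R.symm y))) (t - s) x -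
      oseenDuhamel 1 s (fun τ y => R (u τ (R.symm y))) (fun τ y => R (u τ (R.symm y))) t x
    rw [lineLeaf_oseenDuhamel_conj, lineLeaf_heatFlow_conj, h.mild_eq hst ht (R.symm x), map_sub]
  · -- Type I
    show ‖R (u t (R.symm x))‖ ≤ C / Real.sqrt (-t)
    rw [LinearIsometryEquiv.norm_map]
    exact h.norm_le ht _

/-! ### The Householder reflection and the `x₂`-leaf on an end -/

-- adapted from Cruxes/HelicalEndLiouville/Disproof.lean §4
-- (`exists_linearIsometryEquiv_map_eq_single`, `translationLeaf_axis1`, `translationLeaf`), with the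
-- finite translation invariance as hypothesis

/-- A linear isometry of `ℝ³` taking `L` to `‖L‖ e₂` (the Householder reflection in the
hyperplane orthogonal to `L − ‖L‖e₂`, `Submodule.reflection_sub`). [folklore] -/
theorem lineLeaf_exists_linearIsometryEquiv_map_eq_single (L : E3) :
    ∃ R : E3 ≃ₗᵢ[ℝ] E3, R L = EuclideanSpace.single 1 ‖L‖ := by
  have hn : ‖L‖ = ‖(EuclideanSpace.single (1 : Fin 3) ‖L‖ : E3)‖ := by
    simp
  exact ⟨_, Submodule.reflection_sub hn⟩

/-- **The `x₂`-leaf on a backward end** (KNSS 2009, proof of Thm 6.2 with Thm 5.1, in the tree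
`KNSS2009_typeI_rate_liouville_holds`): an element of `A_C` invariant under all translations
along `e₂` on an end `t < θ ≤ 0` vanishes there — shift time by `σ = (−θ − t₀)/2 > 0`
(`IsTypeIAncientMild.comp_sub_right`) to obtain a field bounded by `C/√σ` and `e₂`-invariant on
all of `t < 0`, then apply the tree theorem at `(t₀ + σ, x₀)`.
[cite: KochNadirashviliSereginSverak2009, proof of Thm 6.2 (arXiv:0709.3599 p. 13)] -/
theorem lineLeaf_axis1 {C : ℝ} {u : ℝ → E3 → E3} (hu : IsTypeIAncientMild C u)
    {θ : ℝ} (hθ : θ ≤ 0)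
    (hsym : ∀ t < θ, ∀ (x : E3) (δ : ℝ), u t (x + EuclideanSpace.single 1 δ) = u t x) :
    ∀ t < θ, ∀ x, u t x = 0 := by
  intro t₀ ht₀ x₀
  -- shift into the past by `σ ∈ (−θ, −t₀)`
  set σ : ℝ := (-θ - t₀) / 2 with hσ
  have hσθ : -θ < σ := by rw [hσ]; linarith
  have hσ0 : 0 < σ := lt_of_le_of_lt (neg_nonneg.2 hθ) hσθ
  have hσt : t₀ + σ < 0 := by rw [hσ]; linarith
  set v : ℝ → E3 → E3 := fun t => u (t - σ) with hv
  have hvmem : IsTypeIAncientMild C v := hu.comp_sub_right hσ0.le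
  have hC : 0 ≤ C := hu.nonneg
  -- the six hypotheses of the tree theorem
  have h1 : ContinuousOn (uncurry v) (Iio 0 ×ˢ univ) := hvmem.continuousOn_uncurry
  have h2 : ∃ K : ℝ, ∀ t < 0, ∀ x, ‖v t x‖ ≤ K := by
    refine ⟨C / Real.sqrt σ, fun t ht x => ?_⟩
    have key := hu.norm_le (t := t - σ) (by linarith) x
    refine key.trans ?_
    exact div_le_div_of_nonneg_left hC (Real.sqrt_pos.2 hσ0) (Real.sqrt_le_sqrt (by linarith))
  have h3 : ∀ t < 0, IsWeaklyDivFree (v t) := fun t ht => hvmem.isWeaklyDivFree ht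
  have h4 : ∀ s t : ℝ, s < t → t < 0 → ∀ x,
      v t x = heatExtension (v s) (t - s) x - oseenDuhamel 1 s v v t x :=
    fun s t hst ht x => hvmem.mild_eq_heatExtension hst ht x
  have h5 : ∀ t < 0, ∀ (x : E3) (δ : ℝ), v t (x + EuclideanSpace.single 1 δ) = v t x :=
    fun t ht x δ => hsym (t - σ) (by linarith) x δ
  have h6 : ∀ t < 0, ∀ x, Real.sqrt (-t) * ‖v t x‖ ≤ C := by
    intro t ht x
    have hs : 0 < Real.sqrt (-t) := Real.sqrt_pos.2 (by linarith)
    have key := hvmem.norm_le ht x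
    rw [le_div_iff₀ hs] at key
    linarith [mul_comm (Real.sqrt (-t)) ‖v t x‖]
  have hzero := KNSS2009_typeI_rate_liouville_holds h1 h2 h3 h4 h5 h6 (t₀ + σ) hσt x₀
  simpa [hv] using hzero

/-- **Stub 6 (the 2.5-D leaf on an end, direction-free).** An element of `A_C` invariant under
all translations along a line `ℝL` (`L ≠ 0`) on a backward end `t < T ≤ 0` vanishes on that end:
rotate `L` onto `‖L‖e₂` (rotation covariance of `A_C`: `K(τ, Rz)[Ra, Rb] = R K(τ, z)[a, b]`,
`e^{σΔ}` commutes with isometries), shift time by `σ > 0` to make the field bounded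
(`IsTypeIAncientMild.comp_sub_right`), and apply the PROVED tree theorem
`KNSS2009_typeI_rate_liouville_holds` (KNSS 2009, proof of Thm 6.2 with Thm 5.1). [cite: KochNadirashviliSereginSverak2009, proof of Thm 6.2 (arXiv:0709.3599 p. 13)] -/
theorem stub_lineLiouvilleEnd :
    ∀ (C : ℝ) (u : ℝ → E3 → E3), IsTypeIAncientMild C u → ∀ (L : E3) (T : ℝ), L ≠ 0 → T ≤ 0 →
      (∀ t < T, ∀ (x : E3) (s : ℝ), u t (x + s • L) = u t x) → ∀ t < T, ∀ x, u t x = 0 := by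
  intro C u hu L T hL hT hinv
  obtain ⟨R, hR⟩ := lineLeaf_exists_linearIsometryEquiv_map_eq_single L
  have hw : IsTypeIAncientMild C (fun t y => R (u t (R.symm y))) :=
    lineLeaf_isTypeIAncientMild_conj hu R
  have hc : ‖L‖ ≠ 0 := norm_ne_zero_iff.2 hL
  -- `R⁻¹ (δ e₂) = (δ/‖L‖) L`
  have hpull : ∀ δ : ℝ, R.symm (EuclideanSpace.single 1 δ) = (δ / ‖L‖) • L := by
    intro δ
    have e1 : R ((δ / ‖L‖) • L) = EuclideanSpace.single (1 : Fin 3) δ := by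
      rw [LinearIsometryEquiv.map_smul, hR]
      ext i
      by_cases hi : i = 1
      · subst hi; simp [div_mul_cancel₀ δ hc]
      · simp [hi]
    rw [← e1, LinearIsometryEquiv.symm_apply_apply]
  -- the conjugate field is invariant under all translations along `e₂` on the end
  have hsymw : ∀ t < T, ∀ (y : E3) (δ : ℝ),
      R (u t (R.symm (y + EuclideanSpace.single 1 δ))) = R (u t (R.symm y)) := by
    intro t ht y δ
    rw [map_add, hpull δ, hinv t ht (R.symm y) (δ / ‖L‖)]
  intro t ht x
  have key := lineLeaf_axis1 hw hT hsymw t ht (R x)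
  simpa using key

end Summit.NavierStokesRegularity.NavierStokesRegularity.Theorems

end
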